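import Summits.Ventures.PercRepro.RankLevelSetUpNoQuad
import Summits.Ventures.PercRepro.RankLevelSetThroughMinorPair

/-! # RankLevelSetUpPairChain — THE UP-SHADOW CHAIN OF THE THROUGH-`{b,c}` PROFILE: THE PAIR (↑) AT EVERY LEVEL
ON COLOOP-FREE MATROIDS OF NULLITY `≤ 3`, AT LEVELS `≥ 4` WITHOUT A SERIES TRIPLE AND AT LEVELS `≥ 5` WITHOUT A
SERIES QUADRUPLE ON NULLITY `≤ 4` (night-1 g40; dossier §52.12; on `RankLevelSetUpNoQuad` and
`RankLevelSetThroughMinorPair`)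

For `W ∈ D_k` through `b` and `c` the up-neighbours `W ∪ {t}` (`t ∈ E ∖ W`, `t ∉ cl W`) are again bi-independent
through `b` and `c`, and a member at level `k + 1` has at most `k − 1` down-neighbours `W' ∖ {t}` (`t ∉ {b, c}`),
so with a coloop bound `c₀`: `(#E − k − c₀) · T^{bc}_k ≤ (k − 1) · T^{bc}_{k+1}` (**`upPairFam_step`**) — one
better than `upFam_step`. With `c₀ = 2` the chain telescopes (`le_of_chain`) to `T^{bc}_k ≤ T^{bc}_{#E − 1 − k}`,
which is the pair (↑) at level `k` (**`upPairAt_of_bound_two`**). The coloop bounds of `RankLevelSetUpChain` and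
`RankLevelSetUpNoQuad` then give **`upPairAt_of_nullity_three`**, **`upPairAt_of_no_triple`** and
**`upPairAt_of_no_quad`**. Every declaration has a docstring; imports: the cell's own modules and Mathlib only.
Axioms: standard. -/

namespace PercRepro

open Set Matroid

variable {α : Type} (M : Matroid α) [M.Finite]

/-- The through-`{b,c}` family at level `k` is finite. -/
lemma throughPair_finite (b c : α) (k : ℕ) : {W ∈ biIndep M k | b ∈ W ∧ c ∈ W}.Finite :=
  (biIndep_finite M k).subset (fun _ h => h.1)

/-- **THE UP-SHADOW STEP OF THE THROUGH-`{b,c}` PROFILE WITH A COLOOP BOUND `c₀`**: if for every `W ∈ D_k` through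
`b` and `c` at most `c₀` elements of `E ∖ W` lie in `cl W`, then `(#E − k − c₀) · T^{bc}_k ≤ (k − 1) · T^{bc}_{k+1}`:
every such `W` has at least `#E − k − c₀` up-neighbours, and every member at level `k + 1` has at most `k − 1`
down-neighbours `W' ∖ {t}` (`t ∉ {b, c}`). -/
theorem upPairFam_step {b c : α} (hbc : b ≠ c) {k c₀ : ℕ}
    (hbound : ∀ W ∈ biIndep M k, b ∈ W → c ∈ W → {t ∈ M.E \ W | t ∈ M.closure W}.ncard ≤ c₀) :
    (M.E.ncard - k - c₀) * {W ∈ biIndep M k | b ∈ W ∧ c ∈ W}.ncard ≤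
      (k - 1) * {W ∈ biIndep M (k + 1) | b ∈ W ∧ c ∈ W}.ncard := by
  classical
  have hAfin := throughPair_finite M b c k
  have hBfin := throughPair_finite M b c (k + 1)
  set I : Finset (Set α × Set α) := (hAfin.toFinset ×ˢ hBfin.toFinset).filter (fun p => p.1 ⊆ p.2) with hI
  -- LOWER BOUND
  have hlow : (M.E.ncard - k - c₀) * hAfin.toFinset.card ≤ I.card := by
    refine Finset.mul_card_image_le_card_of_maps_to (f := Prod.fst) ?_ _ ?_
    · intro p hp
      rw [hI, Finset.mem_filter, Finset.mem_product] at hp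
      exact hp.1.1
    · intro W hW
      have hWA := hAfin.mem_toFinset.mp hW
      obtain ⟨⟨hWE, hWk, hWi, hWc⟩, hbW, hcW⟩ := hWA
      have hWfin : W.Finite := M.ground_finite.subset hWE
      set Y := M.E \ W with hY
      have hYfin : Y.Finite := M.ground_finite.subset Set.sdiff_subset
      have hYcard : Y.ncard = M.E.ncard - k := by rw [hY, Set.ncard_sdiff' hWE M.ground_finite, hWk]
      have hcol : {t ∈ Y | t ∈ M.closure W}.ncard ≤ c₀ := hbound W ⟨hWE, hWk, hWi, hWc⟩ hbW hcW
      have hmaps : ∀ t ∈ Y \ {t ∈ Y | t ∈ M.closure W},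
          (W, insert t W) ∈ I.filter (fun p => p.1 = W) := by
        intro t ht
        have htY : t ∈ Y := ht.1
        have htcl : t ∉ M.closure W := fun h => ht.2 ⟨htY, h⟩
        rw [Finset.mem_filter, hI, Finset.mem_filter, Finset.mem_product]
        refine ⟨⟨⟨hW, ?_⟩, Set.subset_insert t W⟩, rfl⟩
        rw [hBfin.mem_toFinset]
        refine ⟨⟨Set.insert_subset htY.1 hWE, ?_, ?_, ?_⟩, Set.mem_insert_of_mem t hbW,
          Set.mem_insert_of_mem t hcW⟩
        · rw [Set.ncard_insert_of_notMem htY.2 hWfin, hWk]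
        · exact (hWi.insert_indep_iff_of_notMem htY.2).mpr ⟨htY.1, htcl⟩
        · exact hWc.subset (Set.sdiff_subset_sdiff_right (Set.subset_insert t W))
      have hinj : Set.InjOn (fun t => (W, insert t W)) (Y \ {t ∈ Y | t ∈ M.closure W}) := by
        intro t₁ ht₁ t₂ ht₂ heq
        have h : insert t₁ W = insert t₂ W := congrArg Prod.snd heq
        have : t₁ ∈ insert t₂ W := h ▸ Set.mem_insert t₁ W
        rcases this with h' | h'
        · exact h'
        · exact absurd h' ht₁.1.2
      have hcard1 : (Y \ {t ∈ Y | t ∈ M.closure W}).ncard = Y.ncard - {t ∈ Y | t ∈ M.closure W}.ncard :=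
        Set.ncard_sdiff (fun t ht => ht.1) (hYfin.subset (fun t ht => ht.1))
      calc M.E.ncard - k - c₀ ≤ (Y \ {t ∈ Y | t ∈ M.closure W}).ncard := by
            rw [hcard1, hYcard]; omega
        _ = ((fun t => (W, insert t W)) '' (Y \ {t ∈ Y | t ∈ M.closure W})).ncard :=
            hinj.ncard_image.symm
        _ ≤ (I.filter (fun p => p.1 = W)).card := by
            rw [← Set.ncard_coe_finset]
            refine Set.ncard_le_ncard ?_ (Finset.finite_toSet _)
            rintro p ⟨t, ht, rfl⟩
            exact hmaps t ht
  -- UPPER BOUND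
  have hup : I.card ≤ (k - 1) * hBfin.toFinset.card := by
    refine Finset.card_le_mul_card_image_of_maps_to (f := Prod.snd) ?_ _ ?_
    · intro p hp
      rw [hI, Finset.mem_filter, Finset.mem_product] at hp
      exact hp.1.2
    · intro W' hW'
      have hW'B := hBfin.mem_toFinset.mp hW'
      have hW'fin : W'.Finite := M.ground_finite.subset hW'B.1.1
      have hex : ∀ p ∈ I.filter (fun p => p.2 = W'), ∃ t ∈ W' \ {b, c}, p.1 = W' \ {t} := by
        intro p hp
        rw [Finset.mem_filter, hI, Finset.mem_filter, Finset.mem_product] at hp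
        obtain ⟨⟨⟨hpA, -⟩, hsub⟩, hp2⟩ := hp
        rw [hp2] at hsub
        have hpA' := hAfin.mem_toFinset.mp hpA
        have h1 : (W' \ p.1).ncard = 1 := by
          rw [Set.ncard_sdiff hsub (M.ground_finite.subset hpA'.1.1), hW'B.1.2.1, hpA'.1.2.1]; omega
        obtain ⟨t, ht⟩ := Set.ncard_eq_one.mp h1
        have htW' : t ∈ W' \ p.1 := by rw [ht]; exact Set.mem_singleton t
        refine ⟨t, ⟨htW'.1, ?_⟩, ?_⟩
        · simp only [Set.mem_insert_iff, Set.mem_singleton_iff, not_or]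
          exact ⟨fun hb => htW'.2 (hb ▸ hpA'.2.1), fun hc => htW'.2 (hc ▸ hpA'.2.2)⟩
        ext x
        constructor
        · intro hx
          exact ⟨hsub hx, fun h => htW'.2 (by rw [Set.mem_singleton_iff] at h; rw [← h]; exact hx)⟩
        · intro hx
          by_contra hxp
          have : x ∈ W' \ p.1 := ⟨hx.1, hxp⟩
          rw [ht, Set.mem_singleton_iff] at this
          exact hx.2 (by rw [this]; exact Set.mem_singleton t)
      choose g hg using hex
      set g' : Set α × Set α → α := fun p => if h : p ∈ I.filter (fun p => p.2 = W') then g p h else b with hg'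
      have hg'eq : ∀ p (hp : p ∈ I.filter (fun p => p.2 = W')), g' p = g p hp := by
        intro p hp
        simp only [hg', dif_pos hp]
      have hWbcfin : (W' \ {b, c}).Finite := hW'fin.subset Set.sdiff_subset
      calc (I.filter (fun p => p.2 = W')).card ≤ hWbcfin.toFinset.card := by
            refine Finset.card_le_card_of_injOn g' ?_ ?_
            · intro p hp
              rw [Finset.mem_coe] at hp
              rw [Finset.mem_coe, hWbcfin.mem_toFinset, hg'eq p hp]
              exact (hg p hp).1
            · intro p hp q hq heq
              rw [Finset.mem_coe] at hp hq
              rw [hg'eq p hp, hg'eq q hq] at heq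
              have hp' := Finset.mem_filter.mp hp
              have hq' := Finset.mem_filter.mp hq
              refine Prod.ext ?_ (hp'.2.trans hq'.2.symm)
              rw [(hg p hp).2, (hg q hq).2, heq]
        _ = k - 1 := by
          rw [← Set.ncard_eq_toFinset_card _ hWbcfin,
            Set.ncard_sdiff (Set.pair_subset hW'B.2.1 hW'B.2.2) (Set.toFinite _), Set.ncard_pair hbc,
            hW'B.1.2.1]
          omega
  rw [Set.ncard_eq_toFinset_card _ hAfin, Set.ncard_eq_toFinset_card _ hBfin]
  exact hlow.trans hup

/-- **THE PAIR (↑) AT LEVEL `k` FROM THE COLOOP BOUND `2` ALONG THE CHAIN**: if every through-`{b,c}` member `W`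
at the levels `k ≤ j ≤ #E − 2 − k` has at most `2` elements of `E ∖ W` in `cl W`, then the steps
`(#E − j − 2) · T_j ≤ (j − 1) · T_{j+1}` telescope to `T_k ≤ T_{#E − 1 − k}`, i.e. `BiIndepUpPairAt M b c k`
(`2 ≤ k`, `2k + 2 ≤ #E`). -/
theorem upPairAt_of_bound_two {b c : α} (hb : b ∈ M.E) (hc : c ∈ M.E) (hbc : b ≠ c) {k : ℕ} (hk2 : 2 ≤ k)
    (hk : 2 * k + 2 ≤ M.E.ncard)
    (hbound : ∀ j, k ≤ j → j + k + 2 ≤ M.E.ncard →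
      ∀ W ∈ biIndep M j, b ∈ W → c ∈ W → {t ∈ M.E \ W | t ∈ M.closure W}.ncard ≤ 2) :
    BiIndepUpPairAt M b c k := by
  rw [upPairAt_iff_through_le_through M hb hc (by omega)]
  let f : ℕ → ℕ := fun i => {W ∈ biIndep M (i + 2) | b ∈ W ∧ c ∈ W}.ncard
  have hstep : ∀ t, t < M.E.ncard - 1 - 2 * k →
      (M.E.ncard - k - 2 - t) * f (k - 2 + t) ≤ (k - 2 + t + 1) * f (k - 2 + t + 1) := by
    intro t ht
    have e1 : k - 2 + t + 2 = k + t := by omega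
    have e2 : k - 2 + t + 1 + 2 = k + t + 1 := by omega
    have e3 : k - 2 + t + 1 = k + t - 1 := by omega
    have e4 : M.E.ncard - k - 2 - t = M.E.ncard - (k + t) - 2 := by omega
    show (M.E.ncard - k - 2 - t) * {W ∈ biIndep M (k - 2 + t + 2) | b ∈ W ∧ c ∈ W}.ncard ≤
      (k - 2 + t + 1) * {W ∈ biIndep M (k - 2 + t + 1 + 2) | b ∈ W ∧ c ∈ W}.ncard
    rw [e1, e2, e3, e4]
    exact upPairFam_step M hbc (k := k + t) (c₀ := 2) (hbound (k + t) (by omega) (by omega))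
  have hchain := le_of_chain f (a := k - 2) (c := M.E.ncard - k - 2) (m := M.E.ncard - 1 - 2 * k)
    (by omega) hstep
  have h1 : f (k - 2) = {W ∈ biIndep M k | b ∈ W ∧ c ∈ W}.ncard := by
    show {W ∈ biIndep M (k - 2 + 2) | b ∈ W ∧ c ∈ W}.ncard = _
    rw [Nat.sub_add_cancel hk2]
  have h2 : f (k - 2 + (M.E.ncard - 1 - 2 * k)) = {W ∈ biIndep M (M.E.ncard - 1 - k) | b ∈ W ∧ c ∈ W}.ncard := by
    show {W ∈ biIndep M (k - 2 + (M.E.ncard - 1 - 2 * k) + 2) | b ∈ W ∧ c ∈ W}.ncard = _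
    have e : k - 2 + (M.E.ncard - 1 - 2 * k) + 2 = M.E.ncard - 1 - k := by omega
    rw [e]
  rw [← h1, ← h2]
  exact hchain

/-- **THE PAIR (↑) AT EVERY LEVEL `k ≥ 2` ON A COLOOP-FREE MATROID OF NULLITY `≤ 3`** (`2k + 2 ≤ #E`). -/
theorem upPairAt_of_nullity_three (hcol : ∀ e, ¬ M.IsColoop e) (hν : M✶.eRank ≤ 3) {b c : α} (hb : b ∈ M.E)
    (hc : c ∈ M.E) (hbc : b ≠ c) {k : ℕ} (hk2 : 2 ≤ k) (hk : 2 * k + 2 ≤ M.E.ncard) :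
    BiIndepUpPairAt M b c k := by
  refine upPairAt_of_bound_two M hb hc hbc hk2 hk ?_
  intro j hkj hj W hW _ _
  exact bound_two_of_nullity_three M hcol hν hW (by omega)

/-- **THE PAIR (↑) AT EVERY LEVEL `k ≥ 4` ON A COLOOP-FREE MATROID OF NULLITY `≤ 4` WITHOUT A SERIES TRIPLE**
(`2k + 2 ≤ #E`). -/
theorem upPairAt_of_no_triple (hcol : ∀ e, ¬ M.IsColoop e) (hν : M✶.eRank ≤ 4) (hnt : NoSeriesTriple M)
    {b c : α} (hb : b ∈ M.E) (hc : c ∈ M.E) (hbc : b ≠ c) {k : ℕ} (hk4 : 4 ≤ k) (hk : 2 * k + 2 ≤ M.E.ncard) :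
    BiIndepUpPairAt M b c k := by
  refine upPairAt_of_bound_two M hb hc hbc (by omega) hk ?_
  intro j hkj hj W hW _ _
  exact bound_two_of_no_triple M hcol hν hnt hW (by omega)

/-- **THE PAIR (↑) AT EVERY LEVEL `k ≥ 5` ON A COLOOP-FREE MATROID OF NULLITY `≤ 4` WITHOUT A SERIES QUADRUPLE**
(`2k + 2 ≤ #E`). -/
theorem upPairAt_of_no_quad (hcol : ∀ e, ¬ M.IsColoop e) (hν : M✶.eRank ≤ 4) (hnq : NoSeriesQuad M)
    {b c : α} (hb : b ∈ M.E) (hc : c ∈ M.E) (hbc : b ≠ c) {k : ℕ} (hk5 : 5 ≤ k) (hk : 2 * k + 2 ≤ M.E.ncard) :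
    BiIndepUpPairAt M b c k := by
  refine upPairAt_of_bound_two M hb hc hbc (by omega) hk ?_
  intro j hkj hj W hW _ _
  exact bound_two_of_no_quad M hcol hν hnq hW (by omega)

end PercRepro
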